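import Summits.QuantumFields.BalabanUV.Beta.EriceRemainderEnclosureHistoryAutonomyComparisonZonesUniform
import Summits.QuantumFields.BalabanUV.Beta.EriceRemainderEnclosureHistoryAutonomyComparisonTower

/-!
# EriceRemainderEnclosureHistoryAutonomyComparisonTowerUniform — (E63c) HYPER-SEPARATED TOWERS WITH A MARKOV RIDER, SEPARATION LINEAR IN THE HEIGHT:
# `B(u) = b + L_0·u_0 + Σ_{k∈A} L_k·u_k` (`L_0 ≥ 0` and the sizes `L_k ≥ 0`, `k ∈ A ⊆ [1, K[`, ARBITRARY; pairwise ratios of the `n` ages at most `t`)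
# compares at any size under every isotone excess with a zeroth moment as soon as **`(3(√2∕2)(n−1) + 4)·t ≤ 2·(1 − √2∕2)^n`** — (E62b) needed
# `(n² + 4)·t ≤ 2(1−√2∕2)^n` and no Markov weight; integer ratios `R ≥ 36 ∕ 165 ∕ 704 ∕ 2896` for `n = 2 ∕ 3 ∕ 4 ∕ 5` (were `47 ∕ 260 ∕ 1400 ∕ 6800`);
# THREE AGES with consecutive ratios `≥ 165` and ANY Markov weight compare at any size

Cell `pub-balaban`, β-function sub-cell, BINDER row D4 «RemainderConst leaves for Bałaban's split» (`HOME/BINDER-OWNERS.md`; owner lineage `b2b-balaban-beta-an4`;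
this file by co-owner #2 lineage `b2b-balaban-beta-d4-p2`, generation 56), β-FLOW TEAM duty (1), FREEZE (0) honoured (def-free; (E63b)'s
`le_of_isotone_excess_zones_uniform` (singleton zones), (E62a)'s `one_sub_sqrt_two_div_two_bounds`, (E62b)'s `card_triple` BY NAME; nothing
restated).  Sequel of (E63b) `…ComparisonZonesUniform`.

HONEST FRAMING (page 1, verbatim and binding).  *"Discharging BetaPertH makes Bałaban's UV stability UNCONDITIONAL — a real constructive-QFT result; it is
NOT the continuum limit and NOT the Clay problem."*  THIS FILE DISCHARGES NOTHING OF THE KIND.  Elementary real analysis about ABSTRACT affine functionals on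
a box ]0,γ]^ℕ with displayed supports and signs — hypotheses of a census, not facts; the form, signs, ages and moments of Bałaban's (1.22) limit functional
are NOT PRINTED ([I] p. 298; GAPS G-t4-U2-1∕-2) and NOT asserted.  Row D4 class UNCHANGED (critical-path width 0; instance 0∕1; D4 DISCHARGE NO DATE).
HONEST DEPENDENCY: continuum YM on T⁴ ⇐ BetaPertH ∧ nine spine estimates (0/9 proved); BetaPertH ⇐ (D1) ∧ (D4) ∧ CAP+tail; G-an2-4 gates asym, D1 and
NE2/3/4.

THE POINT (census sense (α); the COMPARISON column, conjecture (E58′)).  Singleton zones pass (E58b)'s profile condition with margin `q = √2∕2` (§1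
`ratio_le_sqrt_two`: `L_k ∕ P_k ≤ √2`, the age's own read `√(k∕2k)`), so (E63b)'s uniform zones theorem specialises to towers with the separation condition
LINEAR in the height `n` and with an arbitrary Markov weight riding along (§2 `le_of_isotone_excess_tower_uniform`, integer form §2
`le_of_isotone_excess_tower_ratio_uniform`); §3 `le_of_isotone_excess_three_ages_uniform`: `k₂ ≥ 165·k₁`, `k₃ ≥ 165·k₂`, sizes and Markov weight
ARBITRARY ((E62b): `260`, no Markov weight).  THE PICTURE after (E63): zm alone ⟺ `M·γ ≤ 3√3·b`; one age, profile-bounded blocks, fading profiles, uniform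
windows, ANY two ages — free; hyper-separated towers ∕ profile-bounded zones — free with separation `(3q(N−1)+4)·t ≤ 2(1−q)^N` INDEPENDENT OF THE NUMBER OF
AGES and with a Markov rider; the drop at every scale is a priori `≤ (3∕2)·η` for every profile.  OPEN: three or more ages ∕ zones at intermediate ratios;
dense profiles of unbounded level weight beyond the profile condition.  NOT CLAIMED: anything below the stated thresholds; anything printed.

WHAT IS PROVED ([folklore]; 0 `def`, 0 sorry).  §1 **`ratio_le_sqrt_two`**, `singleton_zone_sum_le`.  §2 **`le_of_isotone_excess_tower_uniform`**,
**`le_of_isotone_excess_tower_ratio_uniform`**.  §3 **`le_of_isotone_excess_three_ages_uniform`**.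
-/
noncomputable section
open Finset Set

namespace Summit.QuantumFields.BalabanUV.Beta.EriceRemainderEnclosureHistoryAutonomyComparisonTowerUniform

open Literature.MathematicalPhysics.QuantumFieldTheory.Balaban1983to89
open Literature.MathematicalPhysics.QuantumFieldTheory.Balaban1983to89.T4BetaStationary
open Literature.MathematicalPhysics.QuantumFieldTheory.Balaban1983to89.T4BetaFlowWellPosed
open Summit.QuantumFields.BalabanUV.Beta.EriceRemainderEnclosureHistoryAutonomyComparisonTowerLemmas (one_sub_sqrt_two_div_two_bounds)
open Summit.QuantumFields.BalabanUV.Beta.EriceRemainderEnclosureHistoryAutonomyComparisonTower (card_triple)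
open Summit.QuantumFields.BalabanUV.Beta.EriceRemainderEnclosureHistoryAutonomyComparisonZonesUniform (le_of_isotone_excess_zones_uniform)

variable {B' : (ℕ → ℝ) → ℝ} {M' γ b t : ℝ} {L : ℕ → ℝ} {K : ℕ} {h h' : ℕ → ℝ} {A : Finset ℕ}

/-! ## §1 Singleton zones pass the profile condition with margin `√2∕2` -/

/-- **A SINGLE AGE READS ITSELF WITH WEIGHT `√(1∕2)`**: for `L ≥ 0` and an age `1 ≤ j < K`, `L_j ∕ P_j ≤ √2`, `P_j = Σ_{k<K} L_k·√(j∕(j+k))` — the `k = j`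
summand alone gives `P_j ≥ L_j∕√2` (division by a vanishing `P_j` reads `0` in Lean and the bound holds trivially). [folklore] -/
theorem ratio_le_sqrt_two (hL : ∀ k, 0 ≤ L k) {j : ℕ} (hj1 : 1 ≤ j) (hjK : j ∈ range K) :
    L j / ∑ k ∈ range K, L k * Real.sqrt ((j : ℝ) / ((j : ℝ) + k)) ≤ Real.sqrt 2 := by
  have hjr : (0 : ℝ) < j := by exact_mod_cast hj1
  have hs2 : 0 < Real.sqrt 2 := by positivity
  set P : ℝ := ∑ k ∈ range K, L k * Real.sqrt ((j : ℝ) / ((j : ℝ) + k)) with hP_def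
  -- the own read: √(j/(j+j)) = √(1/2), and √2·√(1/2) = 1
  have hhalf : (j : ℝ) / ((j : ℝ) + j) = 1 / 2 := by field_simp; ring
  have hown : L j * Real.sqrt (1 / 2) ≤ P := by
    rw [← hhalf]
    exact single_le_sum (f := fun k => L k * Real.sqrt ((j : ℝ) / ((j : ℝ) + k)))
      (fun k _ => mul_nonneg (hL k) (Real.sqrt_nonneg _)) hjK
  have hprod : Real.sqrt 2 * Real.sqrt (1 / 2) = 1 := by
    rw [← Real.sqrt_mul (by norm_num)]; norm_num
  have hLP : L j ≤ Real.sqrt 2 * P := by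
    calc L j = L j * (Real.sqrt 2 * Real.sqrt (1 / 2)) := by rw [hprod, mul_one]
      _ = Real.sqrt 2 * (L j * Real.sqrt (1 / 2)) := by ring
      _ ≤ Real.sqrt 2 * P := mul_le_mul_of_nonneg_left hown hs2.le
  rcases eq_or_lt_of_le (le_trans (mul_nonneg (hL j) (Real.sqrt_nonneg _)) hown) with hP0 | hPpos
  · rw [← hP0, div_zero]; exact hs2.le
  · rw [div_le_iff₀ hPpos]; exact hLP

/-- SINGLETON ZONES PASS THE PROFILE CONDITION WITH MARGIN `√2∕2`: with the identity zone map, the zone of `ζ ∈ A ⊆ [1, K[` is `{ζ}` and its profile sum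
is `L_ζ ∕ P_ζ ≤ 2·(√2∕2)`. [folklore] -/
theorem singleton_zone_sum_le (hL : ∀ k, 0 ≤ L k) (hAK : A ⊆ range K) (hA1 : ∀ k ∈ A, 1 ≤ k) :
    ∀ ζ ∈ A.image (fun k => k), ∑ j ∈ A.filter (fun j => (fun k => k) j = ζ),
      L j / ∑ k ∈ range K, L k * Real.sqrt ((j : ℝ) / ((j : ℝ) + k)) ≤ 2 * (Real.sqrt 2 / 2) := by
  intro ζ hζ
  rw [Finset.image_id'] at hζ
  have hfilt : A.filter (fun j => (fun k => k) j = ζ) = {ζ} := by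
    ext j
    simp only [mem_filter, Finset.mem_singleton]
    exact ⟨fun hj => hj.2, fun hj => ⟨hj ▸ hζ, hj⟩⟩
  rw [hfilt, sum_singleton, show 2 * (Real.sqrt 2 / 2) = Real.sqrt 2 by ring]
  exact ratio_le_sqrt_two hL (hA1 ζ hζ) (hAK hζ)

/-! ## §2 Towers with a Markov rider, separation linear in the height -/

/-- **HYPER-SEPARATED TOWERS OF ANY HEIGHT WITH A MARKOV RIDER COMPARE AT ANY SIZE, SEPARATION LINEAR IN THE HEIGHT.**  `B = b + Σ_{k<K} L_k·u_k` on ]0,γ]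
with `b > 0`, `L ≥ 0` supported on `{0} ∪ A`, `A ⊆ [1, K[` a finite set of `n` ages with `k ≤ t·k′` for `k < k′` in `A`, `t ≥ 0`,
**`(3(√2∕2)(n−1) + 4)·t ≤ 2·(1 − √2∕2)^n`** — the sizes `L_k` AND the Markov weight `L_0` ARBITRARY; `B′` with zeroth moment `M′ ≥ 0`, `B ≤ B′`, ISOTONE
excess; `h`, `h′` ANY box solutions of `B`, `B′` from one pin `p ∈ ]0,γ]`.  Then `h′ ≤ h` at EVERY scale ((E63b) with singleton zones). [folklore] -/
theorem le_of_isotone_excess_tower_uniform {p : ℝ} (hL : ∀ k, 0 ≤ L k) (hb : 0 < b) (hAK : A ⊆ range K) (hA1 : ∀ k ∈ A, 1 ≤ k)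
    (hsupp : ∀ k ∈ range K, k ∉ A → k ≠ 0 → L k = 0) (ht0 : 0 ≤ t) (hsep : ∀ k ∈ A, ∀ k' ∈ A, k < k' → (k : ℝ) ≤ t * k')
    (ht : (3 * (Real.sqrt 2 / 2) * ((A.card : ℝ) - 1) + 4) * t ≤ 2 * (1 - Real.sqrt 2 / 2) ^ A.card)
    (hB' : ∀ u u' : ℕ → ℝ, SeqBox γ u → SeqBox γ u' → ∀ D : ℝ, (∀ j, |u j - u' j| ≤ D) → |B' u - B' u'| ≤ M' * D) (hM' : 0 ≤ M')
    (hexc : ∀ u, SeqBox γ u → (fun u : ℕ → ℝ => b + ∑ k ∈ range K, L k * u k) u ≤ B' u)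
    (hDmono : ∀ u v : ℕ → ℝ, SeqBox γ u → SeqBox γ v → (∀ j, u j ≤ v j) →
      B' u - (fun u : ℕ → ℝ => b + ∑ k ∈ range K, L k * u k) u ≤ B' v - (fun u : ℕ → ℝ => b + ∑ k ∈ range K, L k * u k) v)
    (hp : 0 < p) (hpγ : p ≤ γ) (hh : SeqBox γ h) (hf : MemFlow (fun u : ℕ → ℝ => b + ∑ k ∈ range K, L k * u k) p h)
    (hh' : SeqBox γ h') (hf' : MemFlow B' p h') (j : ℕ) : h' j ≤ h j := by
  obtain ⟨hlo, hhi⟩ := one_sub_sqrt_two_div_two_bounds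
  have hcard : (A.image (fun k => k)).card = A.card := by rw [Finset.image_id']
  refine le_of_isotone_excess_zones_uniform (z := fun k => k) (q := Real.sqrt 2 / 2) hL hb hAK hA1 hsupp ht0
    (fun k hk k' hk' hkk' => hsep k hk k' hk' hkk') (by positivity) (by linarith) (singleton_zone_sum_le hL hAK hA1) ?_
    hB' hM' hexc hDmono hp hpγ hh hf hh' hf' j
  rw [hcard]; exact ht

/-- **INTEGER-RATIO FORM**: an integer ratio `R` between any two ages of `A` (`R·k ≤ k′` for `k < k′`) with `3(√2∕2)(n−1) + 4 ≤ 2R·(1 − √2∕2)^n`,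
`n = #A`: e.g. `R ≥ 36` for two ages, `165` for three, `704` for four, `2896` for five (Markov weight arbitrary throughout). [folklore] -/
theorem le_of_isotone_excess_tower_ratio_uniform {p : ℝ} {R : ℕ} (hL : ∀ k, 0 ≤ L k) (hb : 0 < b) (hAK : A ⊆ range K) (hA1 : ∀ k ∈ A, 1 ≤ k)
    (hsupp : ∀ k ∈ range K, k ∉ A → k ≠ 0 → L k = 0) (hsep : ∀ k ∈ A, ∀ k' ∈ A, k < k' → R * k ≤ k')
    (hR : 3 * (Real.sqrt 2 / 2) * ((A.card : ℝ) - 1) + 4 ≤ 2 * R * (1 - Real.sqrt 2 / 2) ^ A.card)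
    (hB' : ∀ u u' : ℕ → ℝ, SeqBox γ u → SeqBox γ u' → ∀ D : ℝ, (∀ j, |u j - u' j| ≤ D) → |B' u - B' u'| ≤ M' * D) (hM' : 0 ≤ M')
    (hexc : ∀ u, SeqBox γ u → (fun u : ℕ → ℝ => b + ∑ k ∈ range K, L k * u k) u ≤ B' u)
    (hDmono : ∀ u v : ℕ → ℝ, SeqBox γ u → SeqBox γ v → (∀ j, u j ≤ v j) →
      B' u - (fun u : ℕ → ℝ => b + ∑ k ∈ range K, L k * u k) u ≤ B' v - (fun u : ℕ → ℝ => b + ∑ k ∈ range K, L k * u k) v)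
    (hp : 0 < p) (hpγ : p ≤ γ) (hh : SeqBox γ h) (hf : MemFlow (fun u : ℕ → ℝ => b + ∑ k ∈ range K, L k * u k) p h)
    (hh' : SeqBox γ h') (hf' : MemFlow B' p h') (j : ℕ) : h' j ≤ h j := by
  obtain ⟨hlo, hhi⟩ := one_sub_sqrt_two_div_two_bounds
  -- the left side of the ratio condition is positive (even for A = ∅: 4 − 3√2∕2 > 0), so R > 0
  have hLHS : 0 < 3 * (Real.sqrt 2 / 2) * ((A.card : ℝ) - 1) + 4 := by
    have : (0 : ℝ) ≤ A.card := Nat.cast_nonneg _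
    nlinarith
  have hRpos : (0 : ℝ) < R := by
    rcases Nat.eq_zero_or_pos R with hR0 | hR0
    · exfalso; rw [hR0] at hR; push_cast at hR; linarith
    · exact_mod_cast hR0
  refine le_of_isotone_excess_tower_uniform (t := 1 / R) hL hb hAK hA1 hsupp (by positivity) ?_ ?_ hB' hM' hexc hDmono hp hpγ hh hf hh' hf' j
  · intro k hk k' hk' hkk'
    have hcast : (R : ℝ) * k ≤ k' := by exact_mod_cast hsep k hk k' hk' hkk'
    rw [one_div_mul_eq_div, le_div_iff₀ hRpos]
    linarith
  · rw [mul_one_div, div_le_iff₀ hRpos]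
    linarith

/-! ## §3 Three ages with consecutive ratios `≥ 165` and any Markov weight -/

/-- **THREE AFFINE AGES FAR APART, WITH A MARKOV RIDER, COMPARE AT ANY SIZE.**  `B(u) = b + L_0·u_0 + L₁·u_{k₁} + L₂·u_{k₂} + L₃·u_{k₃}` on ]0,γ] (`b > 0`;
`L ≥ 0` supported on `{0, k₁, k₂, k₃}`, `1 ≤ k₁`, `165·k₁ ≤ k₂`, `165·k₂ ≤ k₃ < K` — ALL FOUR SIZES ARBITRARY); `B′` with zeroth moment `M′ ≥ 0`, `B ≤ B′`
on the box, the EXCESS `B′ − B` ISOTONE; `h`, `h′` ANY box solutions of `B`, `B′` from one pin `p ∈ ]0,γ]`.  Then `h′ ≤ h` at EVERY scale ((E62b)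
`le_of_isotone_excess_three_ages_far`: ratios `260`, no Markov weight). [folklore] -/
theorem le_of_isotone_excess_three_ages_uniform {p : ℝ} {k₁ k₂ k₃ : ℕ} (hL : ∀ k, 0 ≤ L k) (hb : 0 < b) (hk₁ : 1 ≤ k₁) (h12 : 165 * k₁ ≤ k₂)
    (h23 : 165 * k₂ ≤ k₃) (hk₃K : k₃ < K) (hsupp : ∀ k ∈ range K, k ≠ 0 → k ≠ k₁ → k ≠ k₂ → k ≠ k₃ → L k = 0)
    (hB' : ∀ u u' : ℕ → ℝ, SeqBox γ u → SeqBox γ u' → ∀ D : ℝ, (∀ j, |u j - u' j| ≤ D) → |B' u - B' u'| ≤ M' * D) (hM' : 0 ≤ M')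
    (hexc : ∀ u, SeqBox γ u → (fun u : ℕ → ℝ => b + ∑ k ∈ range K, L k * u k) u ≤ B' u)
    (hDmono : ∀ u v : ℕ → ℝ, SeqBox γ u → SeqBox γ v → (∀ j, u j ≤ v j) →
      B' u - (fun u : ℕ → ℝ => b + ∑ k ∈ range K, L k * u k) u ≤ B' v - (fun u : ℕ → ℝ => b + ∑ k ∈ range K, L k * u k) v)
    (hp : 0 < p) (hpγ : p ≤ γ) (hh : SeqBox γ h) (hf : MemFlow (fun u : ℕ → ℝ => b + ∑ k ∈ range K, L k * u k) p h)
    (hh' : SeqBox γ h') (hf' : MemFlow B' p h') (j : ℕ) : h' j ≤ h j := by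
  have hlt12 : k₁ < k₂ := by omega
  have hlt23 : k₂ < k₃ := by omega
  have hcard := card_triple hlt12 hlt23
  refine le_of_isotone_excess_tower_ratio_uniform (A := {k₁, k₂, k₃}) (R := 165) hL hb ?_ ?_ ?_ ?_ ?_ hB' hM' hexc hDmono hp hpγ hh hf hh' hf' j
  · intro k hk
    simp only [Finset.mem_insert, Finset.mem_singleton] at hk
    rcases hk with rfl | rfl | rfl <;> exact mem_range.mpr (by omega)
  · intro k hk
    simp only [Finset.mem_insert, Finset.mem_singleton] at hk
    rcases hk with rfl | rfl | rfl <;> omega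
  · intro k hk hkA hk0
    simp only [Finset.mem_insert, Finset.mem_singleton, not_or] at hkA
    exact hsupp k hk hk0 hkA.1 hkA.2.1 hkA.2.2
  · intro k hk k' hk' hkk'
    simp only [Finset.mem_insert, Finset.mem_singleton] at hk hk'
    rcases hk with rfl | rfl | rfl <;> rcases hk' with rfl | rfl | rfl <;> omega
  · rw [hcard]
    obtain ⟨hlo, _⟩ := one_sub_sqrt_two_div_two_bounds
    push_cast
    nlinarith [pow_le_pow_left₀ (by norm_num : (0:ℝ) ≤ 0.2928) hlo.le 3]

end Summit.QuantumFields.BalabanUV.Beta.EriceRemainderEnclosureHistoryAutonomyComparisonTowerUniform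

end
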